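import Mathlib
import Summits.MatrixMultiplication.MatrixMultiplication.Theorems.SnSubsetDichotomyNoThresholdSubsetTriplePlancherelStepDefs

/-!
# The J-increment is taxicab-Lipschitz (route `SnSubsetDichotomy`, crux `NoThresholdSubsetTriple`)

Stub `incr_sub_incr_abs_le` ((F5) of the lead-c7 report, app. A) of line
`klr-graded-polynomial-method` (stmt-MatrixMultiplication-8302).

For ANY finite cell set `ν ⊆ ℕ × ℕ` (no Young-diagram hypothesis) and any two cells `y, z`,

  `|x_y − x_z| ≤ |row y − row z| + |col y − col z|`,

where `x_y = R(row y) − C(col y)` is `PlancherelStep.incr`.  Pure bookkeeping: the tail sums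
`R(r) = Σ_{i > r} χ_i` and `C(c) = Σ_{j > c} χ^c_j` have all their terms in `{0, ±1}`, so moving
the cut-off by one step changes each of them by at most one (`tailSum_succ_abs_le`); by induction
moving it by `k` steps changes it by at most `k` (`tailSum_add_abs_le`), whence each tail sum is
`1`-Lipschitz in its cut-off (`tailSum_sub_abs_le`), and the triangle inequality finishes.
-/

open scoped BigOperators
open Literature.RepresentationTheory.FiniteGroups (addableNodes IsAddableNode)

namespace Summit.MatrixMultiplication.MatrixMultiplication.Theorems

open PlancherelStep

set_option linter.dupNamespace false in
/-- Moving the cut-off of a tail sum `Σ_{i ∈ s, a < i} f i` of terms of absolute value `≤ 1` by one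
step changes it by at most one: the difference is the single term `f (a + 1)` (or nothing). -/
private theorem tailSum_succ_abs_le (s : Finset ℕ) (f : ℕ → ℤ) (hf : ∀ i, |f i| ≤ 1) (a : ℕ) :
    |∑ i ∈ s.filter (fun i => a < i), f i - ∑ i ∈ s.filter (fun i => a + 1 < i), f i| ≤ 1 := by
  rw [Finset.sum_filter, Finset.sum_filter, ← Finset.sum_sub_distrib]
  have h : ∀ i ∈ s, ((if a < i then f i else 0) - if a + 1 < i then f i else 0) =
      if i = a + 1 then f i else 0 := by
    intro i _
    by_cases h1 : i = a + 1
    · subst h1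
      simp
    · by_cases h2 : a < i
      · rw [if_pos h2, if_pos (by omega), if_neg h1, sub_self]
      · rw [if_neg h2, if_neg (by omega), if_neg h1, sub_zero]
  rw [Finset.sum_congr rfl h, Finset.sum_ite_eq']
  split_ifs
  · exact hf _
  · simp

set_option linter.dupNamespace false in
/-- Moving the cut-off of a tail sum of terms of absolute value `≤ 1` by `k` steps changes it by at
most `k`. -/
private theorem tailSum_add_abs_le (s : Finset ℕ) (f : ℕ → ℤ) (hf : ∀ i, |f i| ≤ 1) (a k : ℕ) :
    |∑ i ∈ s.filter (fun i => a < i), f i - ∑ i ∈ s.filter (fun i => a + k < i), f i| ≤ k := by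
  induction k with
  | zero => simp
  | succ k ih =>
    rw [← add_assoc]
    calc |∑ i ∈ s.filter (fun i => a < i), f i - ∑ i ∈ s.filter (fun i => a + k + 1 < i), f i|
        ≤ |∑ i ∈ s.filter (fun i => a < i), f i - ∑ i ∈ s.filter (fun i => a + k < i), f i|
          + |∑ i ∈ s.filter (fun i => a + k < i), f i
              - ∑ i ∈ s.filter (fun i => a + k + 1 < i), f i| := abs_sub_le _ _ _
      _ ≤ (k : ℤ) + 1 := add_le_add ih (tailSum_succ_abs_le s f hf (a + k))
      _ = ((k + 1 : ℕ) : ℤ) := by push_cast; rfl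

set_option linter.dupNamespace false in
/-- A tail sum of terms of absolute value `≤ 1` is `1`-Lipschitz in its cut-off. -/
private theorem tailSum_sub_abs_le (s : Finset ℕ) (f : ℕ → ℤ) (hf : ∀ i, |f i| ≤ 1) (a b : ℕ) :
    |∑ i ∈ s.filter (fun i => a < i), f i - ∑ i ∈ s.filter (fun i => b < i), f i|
      ≤ |(a : ℤ) - b| := by
  rcases le_total a b with hab | hab
  · obtain ⟨k, rfl⟩ := Nat.exists_eq_add_of_le hab
    calc _ ≤ (k : ℤ) := tailSum_add_abs_le s f hf a k
      _ = |(a : ℤ) - ((a + k : ℕ) : ℤ)| := by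
          rw [Nat.cast_add, sub_add_cancel_left, abs_neg, Nat.abs_cast]
  · obtain ⟨k, rfl⟩ := Nat.exists_eq_add_of_le hab
    rw [abs_sub_comm]
    calc _ ≤ (k : ℤ) := tailSum_add_abs_le s f hf b k
      _ = |((b + k : ℕ) : ℤ) - b| := by
          rw [Nat.cast_add, add_sub_cancel_left, Nat.abs_cast]

set_option linter.dupNamespace false in
/-- Each row-parity charge `χ_i ∈ {0, ±1}` has absolute value at most one. -/
private theorem abs_rowCharge_le_one (ν : Finset (ℕ × ℕ)) (i : ℕ) : |rowCharge ν i| ≤ 1 := by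
  unfold rowCharge
  split_ifs
  · exact (abs_neg_one_pow i).le
  · simp

set_option linter.dupNamespace false in
/-- Each column-parity charge `χ^c_j ∈ {0, ±1}` has absolute value at most one. -/
private theorem abs_colCharge_le_one (ν : Finset (ℕ × ℕ)) (j : ℕ) : |colCharge ν j| ≤ 1 := by
  unfold colCharge
  split_ifs
  · exact (abs_neg_one_pow j).le
  · simp

set_option linter.dupNamespace false in
/-- **(F5) The J-increment is taxicab-Lipschitz.** For any finite cell set `ν` and cells `y, z`,
`|x_y − x_z| ≤ |row y − row z| + |col y − col z|`: the tails `R`, `C` of the `{0, ±1}`-valued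
parity charges are `1`-Lipschitz in their cut-offs, and `x_y − x_z = (R(row y) − R(row z)) −
(C(col y) − C(col z))`. [folklore] -/
theorem incr_sub_incr_abs_le : ∀ (ν : Finset (ℕ × ℕ)) (y z : ℕ × ℕ),
    |incr ν y - incr ν z| ≤ ((Int.natAbs ((y.1 : ℤ) - z.1) + Int.natAbs ((y.2 : ℤ) - z.2) : ℕ) : ℤ) := by
  intro ν y z
  have h1 : |chargeBelow ν y.1 - chargeBelow ν z.1| ≤ |(y.1 : ℤ) - z.1| :=
    tailSum_sub_abs_le _ _ (abs_rowCharge_le_one ν) y.1 z.1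
  have h2 : |chargeRight ν y.2 - chargeRight ν z.2| ≤ |(y.2 : ℤ) - z.2| :=
    tailSum_sub_abs_le _ _ (abs_colCharge_le_one ν) y.2 z.2
  rw [Nat.cast_add, Int.natCast_natAbs, Int.natCast_natAbs]
  calc |incr ν y - incr ν z|
      = |(chargeBelow ν y.1 - chargeBelow ν z.1) - (chargeRight ν y.2 - chargeRight ν z.2)| := by
        unfold incr
        congr 1
        ring
    _ ≤ |chargeBelow ν y.1 - chargeBelow ν z.1| + |chargeRight ν y.2 - chargeRight ν z.2| :=
        abs_sub _ _
    _ ≤ |(y.1 : ℤ) - z.1| + |(y.2 : ℤ) - z.2| := add_le_add h1 h2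

end Summit.MatrixMultiplication.MatrixMultiplication.Theorems
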